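import Literature.Topology.PlanarFoliations.PieceHomotopy
import Literature.Topology.PlanarFoliations.PatternCycles
import HarnessLib

/-!
# An essential simple polygon out of an essential periodic separatrix walk

Topic: Topology / PlanarFoliations, sequel to `CycleLeafPaths.lean` (the walk of pieces
`polyWalk` of cycle data and `polyLeafLoop_null_iff`), `PieceHomotopy.lean` (pieces of two cycle
data along the same separatrix between the same saddles have homotopic images,
`gPieceFin_homotopic`), `WalkErasure.lean` (loop erasure, `comp_homotopic_refl_of_forall_nodup`)
and `PatternCycles.lean` (simple separatrix polygons `PolyCycle`).

Cycle data `vtx, sx` over a compact set `C` (period `m`, leaf-injective `sx`, but possibly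
repeated punctures) give a closed walk of pieces in the leaf space of `T`. **If the composite of
that walk is not homotopic to a constant path, some vertex-simple closed sub-walk is essential**
(loop erasure), and **a vertex-simple closed sub-walk of the walk of pieces is the walk of pieces
of a simple separatrix polygon** whose separatrices are among the `sx` (`exists_polyCycle_of_subwalk`):
its leaf loop is then not null-homotopic (`exists_polyCycle_of_not_null`). This is the extraction
of the essential simple polygon from the periodic hug walk in Novikov's compact leaf theorem.

## Main statements

* `Walk.toList`, `Walk.comp_homotopic_of_forall₂` (**proved**): positionwise homotopic darts give
  homotopic composites.
* `StarData.exists_polyCycle_of_subwalk`, `StarData.exists_polyCycle_of_not_null` (**proved**).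

## References

* C. Camacho, A. Lins Neto, *Geometric Theory of Foliations*, Birkhäuser (1985), Ch. VII §2
  [CamachoLinsNeto1985].
-/

noncomputable section

open Set Filter Function Metric unitInterval
open _root_.Topology
open Literature.Topology.FourManifolds Literature.Topology.FourManifolds.Foliation

namespace Literature.Topology.PlanarFoliations

/-! ## Walks: the list of darts, positionwise comparison -/

namespace Walk

variable {V : Type*} {Y : Type*} [TopologicalSpace Y] {pos : V → Y} {a b c d : V}

/-- **The list of darts of a walk**, in order. [folklore] -/
def toList : ∀ {a b : V}, Walk pos a b → List (Σ a b : V, Path (pos a) (pos b))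
  | _, _, nil _ => []
  | a, _, @cons _ _ _ _ _ b _ p w => ⟨a, b, p⟩ :: w.toList

/-- The darts of the empty walk. [folklore] -/
@[simp] theorem toList_nil (a : V) : (nil a : Walk pos a a).toList = [] := rfl

/-- The darts of a `cons`. [folklore] -/
@[simp] theorem toList_cons (p : Path (pos a) (pos b)) (w : Walk pos b c) :
    (cons p w).toList = (⟨a, b, p⟩ : Σ a b : V, Path (pos a) (pos b)) :: w.toList := rfl

/-- The list of darts has the length of the walk. [folklore] -/
@[simp] theorem length_toList : ∀ {a b : V} (w : Walk pos a b), w.toList.length = w.length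
  | _, _, nil _ => rfl
  | _, _, cons _ w => by simp [length_toList w]

/-- The list of darts of a concatenation. [folklore] -/
theorem toList_append : ∀ {a b c : V} (w : Walk pos a b) (w' : Walk pos b c), (w.append w').toList = w.toList ++ w'.toList
  | _, _, _, nil _, _ => rfl
  | _, _, _, cons p w, w' => by simp [toList_append w w']

/-- The set of darts is the set of members of the list of darts. [folklore] -/
theorem mem_darts_iff : ∀ {a b : V} (w : Walk pos a b) {e : Σ a b : V, Path (pos a) (pos b)}, e ∈ w.Darts ↔ e ∈ w.toList
  | _, _, nil _, _ => by simp
  | _, _, cons p w, _ => by simp [mem_darts_iff w]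

/-- The source list is the list of sources of the darts. [folklore] -/
theorem srcList_eq_map : ∀ {a b : V} (w : Walk pos a b), w.srcList = w.toList.map (·.1)
  | _, _, nil _ => rfl
  | _, _, cons p w => by simp [srcList_eq_map w]

/-- The first dart starts at the start. [folklore] -/
theorem fst_getElem_zero : ∀ {a b : V} (w : Walk pos a b) (h : 0 < w.toList.length), (w.toList[0]).1 = a
  | _, _, nil _, h => by simp at h
  | _, _, cons _ _, _ => rfl

/-- Consecutive darts are tip to tail. [folklore] -/
theorem snd_fst_getElem : ∀ {a b : V} (w : Walk pos a b) (t : ℕ) (ht : t + 1 < w.toList.length),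
    (w.toList[t]'(by omega)).2.1 = (w.toList[t + 1]).1
  | _, _, nil _, t, ht => by simp at ht
  | _, _, cons p w, 0, ht => by
    cases w with
    | nil _ => simp at ht
    | cons p' w' => rfl
  | _, _, cons p w, t + 1, ht => by
    simp only [toList_cons, List.getElem_cons_succ]
    exact snd_fst_getElem w t (by simpa using ht)

/-- The last dart ends at the end. [folklore] -/
theorem snd_fst_getElem_last : ∀ {a b : V} (w : Walk pos a b) (t : ℕ) (ht : t < w.toList.length),
    t + 1 = w.toList.length → (w.toList[t]).2.1 = b
  | _, _, nil _, t, ht, _ => by simp at ht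
  | _, _, cons p w, 0, _, hl => by
    cases w with
    | nil _ => rfl
    | cons p' w' => simp at hl
  | _, _, cons p w, t + 1, ht, hl => by
    simp only [toList_cons, List.getElem_cons_succ]
    exact snd_fst_getElem_last w t _ (by simpa using hl)

/-- **Two darts agree up to homotopy**: same ends, homotopic paths. [folklore] -/
structure DartRel (e₁ e₂ : Σ a b : V, Path (pos a) (pos b)) : Prop where
  fst : e₁.1 = e₂.1
  snd : e₁.2.1 = e₂.2.1
  hom : e₁.2.2.Homotopic (e₂.2.2.cast (congrArg pos fst) (congrArg pos snd))

/-- **Walks with positionwise homotopic darts have homotopic composites.** [folklore] -/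
theorem comp_homotopic_of_forall₂ : ∀ {a₁ b₁ a₂ b₂ : V} (w₁ : Walk pos a₁ b₁) (w₂ : Walk pos a₂ b₂) (ha : a₁ = a₂) (hb : b₁ = b₂),
    w₁.toList.length = w₂.toList.length →
    (∀ t (h₁ : t < w₁.toList.length) (h₂ : t < w₂.toList.length), DartRel (w₁.toList[t]) (w₂.toList[t])) →
    w₁.comp.Homotopic (w₂.comp.cast (congrArg pos ha) (congrArg pos hb))
  | _, _, _, _, nil _, nil _, ha, _, _, _ => by subst ha; exact Path.Homotopic.refl _
  | _, _, _, _, nil _, cons _ _, _, _, hl, _ => by simp at hl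
  | _, _, _, _, cons _ _, nil _, _, _, hl, _ => by simp at hl
  | _, _, _, _, cons p₁ w₁, cons p₂ w₂, ha, hb, hl, H => by
    obtain ⟨h1, h2, hp⟩ := H 0 (by simp) (by simp)
    simp only [toList_cons, List.getElem_cons_zero] at h1 h2 hp
    subst h1 h2 hb
    have ih := comp_homotopic_of_forall₂ w₁ w₂ rfl rfl (by simpa using hl) fun t ht₁ ht₂ ↦ by
      have := H (t + 1) (by simpa using ht₁) (by simpa using ht₂)
      simpa only [toList_cons, List.getElem_cons_succ] using this
    exact Path.Homotopic.hcomp hp ih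

/-- **Moving the end of a walk along an equality of vertices.** [folklore] -/
def castEnd {a b b' : V} (w : Walk pos a b) (h : b = b') : Walk pos a b' := h ▸ w

/-- The darts are unchanged. [folklore] -/
@[simp] theorem toList_castEnd {a b b' : V} (w : Walk pos a b) (h : b = b') : (w.castEnd h).toList = w.toList := by
  subst h; rfl

/-- The length is unchanged. [folklore] -/
@[simp] theorem length_castEnd {a b b' : V} (w : Walk pos a b) (h : b = b') : (w.castEnd h).length = w.length := by
  subst h; rfl

/-- The set of darts is unchanged. [folklore] -/
@[simp] theorem darts_castEnd {a b b' : V} (w : Walk pos a b) (h : b = b') : (w.castEnd h).Darts = w.Darts := by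
  subst h; rfl

/-- The source list is unchanged. [folklore] -/
@[simp] theorem srcList_castEnd {a b b' : V} (w : Walk pos a b) (h : b = b') : (w.castEnd h).srcList = w.srcList := by
  subst h; rfl

/-- The composite is the composite, recast. [folklore] -/
theorem comp_castEnd {a b b' : V} (w : Walk pos a b) (h : b = b') :
    (w.castEnd h).comp = w.comp.cast rfl (congrArg pos h).symm := by
  subst h; rfl

end Walk

/-! ## Cycle data: the list of darts of the walk of pieces -/

variable {X : Type*} [TopologicalSpace X] [T2Space X] [SecondCountableTopology X] [Nonempty X] {F : Foliation ℝ X} {ι : X → ℂ}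
variable {B : Type*} [NormedAddCommGroup B] {M : Type*} [TopologicalSpace M] {T : Foliation B M} {g : ℂ → M}
variable {hbi : IsBiOriented F}

/-- In `Fin q`, the successor of `t - 1` read in `ℕ` modulo `q` is `t`. [folklore] -/
theorem Fin.val_sub_one_succ_mod {q : ℕ} [NeZero q] (t : Fin q) : (((t - 1 : Fin q) : ℕ) + 1) % q = t := by
  have h := congrArg Fin.val (sub_add_cancel t 1)
  rw [Fin.val_add, Fin.val_one', Nat.add_mod_mod] at h
  exact h

namespace StarData

variable (D : StarData F ι T g) (hι : IsOpenEmbedding ι)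
variable {m : ℕ} [NeZero m] {C : Set ℂ} (hC : IsCompact C) {vtx : Fin m → ℂ} {sx : Fin m → X}
  [hnc : ∀ i, NoncompactSpace (F.Leaf (sx i))]
  (hv : ∀ i, vtx i ∈ D.P) (hmem : ∀ i, ∀ q : F.Leaf (sx i), ι (Leaf.pt q) ∈ C)
  (hω : ∀ i, omegaSet hbi ι (sx i) = {vtx i}) (hα : ∀ i, alphaSet hbi ι (sx (i + 1)) = {vtx i})

/-- **The dart of the piece `k`** of the walk of pieces. [folklore] -/
def dartOf (k : ℕ) : Σ a b : ℂ, Path (D.pos a) (D.pos b) :=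
  ⟨(D.walkJ hι hC hv hmem hω hα k).v, (D.walkJ hι hC hv hmem hω hα (k + 1)).v, D.gPiece hι hC hv hmem hω hα k⟩

/-- **The list of darts of the walk of pieces.** [folklore] -/
theorem toList_polyWalk (n : ℕ) : (D.polyWalk hι hC hv hmem hω hα n).toList = (List.range n).map (D.dartOf hι hC hv hmem hω hα) := by
  induction n with
  | zero => rfl
  | succ n ih => rw [polyWalk, Walk.toList_append, ih, List.range_succ, List.map_append]; rfl

/-- The image of the piece `k` is the image of the piece `idx k`, recast at the end. [folklore] -/
theorem gPiece_eq_cast (k : ℕ) :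
    D.gPiece hι hC hv hmem hω hα k = (D.gPieceFin hι hC hv hmem hω hα (idx m k)).cast rfl (congrArg (fun i ↦ D.pos (vtx i)) (idx_succ k)) := by
  ext; rfl

/-! ## A vertex-simple closed sub-walk of the walk of pieces is the walk of a simple polygon -/

include hnc in
/-- **A vertex-simple closed sub-walk of the walk of pieces, with essential composite, is the walk
of pieces of a simple separatrix polygon with separatrices among the `sx`, whose leaf loop is not
null-homotopic.** [cite: CamachoLinsNeto1985, Ch. VII §2] -/
theorem exists_polyCycle_of_subwalk (hsx : ∀ a b, F.leaf (sx a) = F.leaf (sx b) → a = b) {b : ℂ} (γ : Walk D.pos b b)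
    (h0 : 0 < γ.length) (hD : γ.Darts ⊆ {e | ∃ k < m, e = D.dartOf hι hC hv hmem hω hα k}) (hN : γ.srcList.Nodup)
    (hγ : ¬ γ.comp.Homotopic (Path.refl _)) :
    ∃ Z : D.PolyCycle hbi C, (∀ i, ∃ j, Z.sx i = sx j) ∧ ¬ (Z.leafLoop hι hC).Homotopic (Path.refl _) := by
  -- the darts of `γ`, read as pieces `kf t`
  have hq : γ.toList.length = γ.length := Walk.length_toList γ
  have hmemD : ∀ t (ht : t < γ.toList.length), ∃ k < m, γ.toList[t] = D.dartOf hι hC hv hmem hω hα k := fun t ht ↦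
    hD ((Walk.mem_darts_iff γ).2 (List.getElem_mem ht))
  choose! kf hkf hkfeq using hmemD
  set q := γ.length with hq_def
  haveI : NeZero q := ⟨h0.ne'⟩
  have heq : ∀ t (ht : t < q), γ.toList[t]'(by rw [hq]; exact ht) = D.dartOf hι hC hv hmem hω hα (kf t) := fun t ht ↦
    hkfeq t (by rw [hq]; exact ht)
  -- sources and targets of the darts
  have hsrc : ∀ t (ht : t < q), (γ.toList[t]'(by rw [hq]; exact ht)).1 = vtx (idx m (kf t)) := fun t ht ↦ by rw [heq t ht]; rfl
  have htgt : ∀ t (ht : t < q), (γ.toList[t]'(by rw [hq]; exact ht)).2.1 = vtx (idx m (kf t) + 1) := fun t ht ↦ by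
    rw [heq t ht, ← idx_succ]; rfl
  have hb0 : b = vtx (idx m (kf 0)) := (Walk.fst_getElem_zero γ (by rw [hq]; exact h0)).symm.trans (hsrc 0 h0)
  -- KEY: the target of the dart `u` is the source of the dart `u + 1 (mod q)`
  have hkeyN : ∀ u (hu : u < q), vtx (idx m (kf u) + 1) = vtx (idx m (kf ((u + 1) % q))) := fun u hu ↦ by
    rw [← htgt u hu]
    rcases Nat.lt_or_ge (u + 1) q with h | h
    · rw [Walk.snd_fst_getElem γ u (by rw [hq]; exact h), hsrc (u + 1) h, Nat.mod_eq_of_lt h]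
    · have h' : u + 1 = q := le_antisymm (Nat.succ_le_of_lt hu) h
      rw [Walk.snd_fst_getElem_last γ u (by rw [hq]; exact hu) (by rw [hq]; exact h'), h', Nat.mod_self, ← hb0]
  -- the data of the polygon
  set dk : Fin q → Fin m := fun t ↦ idx m (kf t) with hdk
  have hkey : ∀ t : Fin q, vtx (dk (t - 1) + 1) = vtx (dk t) := fun t ↦ by
    simp only [hdk]
    rw [hkeyN _ (t - 1).isLt, Fin.val_sub_one_succ_mod]
  set vtx' : Fin q → ℂ := fun t ↦ vtx (dk t) with hvtx'
  set sx' : Fin q → X := fun t ↦ sx (dk (t - 1) + 1) with hsx'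
  -- the punctures are distinct: the source list of `γ` has no duplicate
  have hsrcL : ∀ t : Fin q, γ.srcList[(t : ℕ)]'(by rw [Walk.length_srcList]; exact t.isLt) = vtx' t := fun t ↦ by
    simp only [Walk.srcList_eq_map, List.getElem_map, hvtx']
    exact hsrc t t.isLt
  have hinj : Injective vtx' := fun a a' h ↦ by
    rw [← hsrcL a, ← hsrcL a'] at h
    exact Fin.ext ((hN.getElem_inj_iff).1 h)
  let Z : D.PolyCycle hbi C :=
    { m := q
      vtx := vtx'
      sx := sx'
      nc := fun t ↦ hnc _
      hv := fun t ↦ hv _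
      hmem := fun t ↦ hmem _
      hω := fun t ↦ (hω _).trans (by rw [hkey t])
      hα := fun t ↦ by
        have h := hα (dk t)
        have e : sx' (t + 1) = sx (dk t + 1) := by simp only [hsx', add_sub_cancel_right]
        convert h using 2
      hvtx := hinj
      hsx := fun a a' h ↦ by
        have h1 : dk (a - 1) + 1 = dk (a' - 1) + 1 := hsx _ _ h
        have h2 : vtx' (a - 1) = vtx' (a' - 1) := by
          show vtx (dk (a - 1)) = vtx (dk (a' - 1)); rw [add_right_cancel h1]
        simpa using hinj h2 }
  refine ⟨Z, fun i ↦ ⟨_, rfl⟩, fun hnull ↦ hγ ?_⟩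
  -- the leaf loop of `Z` null ⇒ the composite of its walk of pieces is homotopic to a constant
  obtain ⟨R, hR, hhom⟩ := (D.polyLeafLoop_null_iff hι hC Z.hv Z.hmem Z.omega Z.alpha).1 hnull
  -- endpoints
  have hv0 : ∀ t (ht : t < q), Z.vtx (idx q t) = vtx (idx m (kf t)) := fun t ht ↦ by
    show vtx (idx m (kf ((idx q t : Fin q) : ℕ))) = _
    rw [idx_val, Nat.mod_eq_of_lt ht]
  have ha : b = (D.walkJ hι hC Z.hv Z.hmem Z.omega Z.alpha 0).v := by
    rw [walkJ_v, hv0 0 h0]; exact hb0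
  have hb : b = (D.walkJ hι hC Z.hv Z.hmem Z.omega Z.alpha q).v := by
    rw [walkJ_period]; exact ha
  -- positionwise comparison of `γ` with the walk of pieces of `Z`
  have hcomp : γ.comp.Homotopic ((D.polyWalk hι hC Z.hv Z.hmem Z.omega Z.alpha q).comp.cast (congrArg D.pos ha) (congrArg D.pos hb)) := by
    refine Walk.comp_homotopic_of_forall₂ γ _ ha hb (by rw [hq, Walk.length_toList, length_polyWalk]) fun t ht₁ ht₂ ↦ ?_
    have ht : t < q := by rwa [hq] at ht₁
    have e2 : (D.polyWalk hι hC Z.hv Z.hmem Z.omega Z.alpha q).toList[t] = D.dartOf hι hC Z.hv Z.hmem Z.omega Z.alpha t := by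
      simp only [toList_polyWalk, List.getElem_map, List.getElem_range]
    rw [heq t ht, e2]
    -- the three comparisons
    have hvv : vtx (idx m (kf t)) = Z.vtx (idx q t) := (hv0 t ht).symm
    have hvv' : vtx (idx m (kf t) + 1) = Z.vtx (idx q t + 1) := by
      show vtx (idx m (kf t) + 1) = vtx (dk (idx q t + 1))
      rw [← hkey (idx q t + 1), add_sub_cancel_right]
      show vtx (idx m (kf t) + 1) = vtx (idx m (kf ((idx q t : Fin q) : ℕ)) + 1)
      rw [idx_val, Nat.mod_eq_of_lt ht]
    have hyy : sx (idx m (kf t) + 1) = Z.sx (idx q t + 1) := by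
      show sx (idx m (kf t) + 1) = sx (idx m (kf ((idx q t + 1 - 1 : Fin q) : ℕ)) + 1)
      rw [add_sub_cancel_right, idx_val, Nat.mod_eq_of_lt ht]
    have hpc : (D.gPieceFin hι hC hv hmem hω hα (idx m (kf t))).Homotopic ((D.gPieceFin hι hC Z.hv Z.hmem Z.omega Z.alpha (idx q t)).cast
        (congrArg D.pos hvv) (congrArg D.pos hvv')) :=
      D.gPieceFin_homotopic (hnc := fun i ↦ Z.instNoncompactSpace i) (hnc₂ := hnc) hι hC Z.hv Z.hmem Z.omega Z.alpha hC hv hmem hω hα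
        (idx q t) (idx m (kf t)) hvv hvv' hyy
    have e : D.pos (vtx (idx m (kf t + 1))) = D.pos (vtx (idx m (kf t) + 1)) := by rw [idx_succ]
    refine ⟨hvv.trans (D.walkJ_v hι hC Z.hv Z.hmem Z.omega Z.alpha t).symm, ?_, ?_⟩
    · show vtx (idx m (kf t + 1)) = Z.vtx (idx q (t + 1))
      rw [idx_succ, hvv', ← idx_succ]
    · exact Path.Homotopic.cast' hpc rfl e
  -- conclusion: `γ.comp` is homotopic to a constant path, i.e. to `refl`
  have h1 : γ.comp.Homotopic ((R.cast (congrArg D.pos ha) (congrArg D.pos hb))) := hcomp.trans (Path.Homotopic.cast' hhom _ _)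
  have h2 : R.cast (congrArg D.pos ha) (congrArg D.pos hb) = Path.refl _ := by
    refine Path.eq_refl_of_forall_eq fun θ ↦ ?_
    show R θ = D.pos b
    rw [hR θ, hb0, ← hv0 0 h0]
  rwa [h2] at h1

include hnc in
/-- **If the composite of the walk of pieces over a period is not homotopic to a constant path,
some simple separatrix polygon with separatrices among the `sx` has a leaf loop that is not
null-homotopic** (loop erasure). [cite: CamachoLinsNeto1985, Ch. VII §2] -/
theorem exists_polyCycle_of_not_null (hsx : ∀ a b, F.leaf (sx a) = F.leaf (sx b) → a = b)
    (hess : ¬ ∃ R : Path (D.pos (D.walkJ hι hC hv hmem hω hα 0).v) (D.pos (D.walkJ hι hC hv hmem hω hα m).v),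
      (∀ θ, R θ = D.pos (vtx (idx m 0))) ∧ (D.polyWalk hι hC hv hmem hω hα m).comp.Homotopic R) :
    ∃ Z : D.PolyCycle hbi C, (∀ i, ∃ j, Z.sx i = sx j) ∧ ¬ (Z.leafLoop hι hC).Homotopic (Path.refl _) := by
  by_contra hZ
  simp only [not_exists, not_and, not_not] at hZ
  apply hess
  have hend : (D.walkJ hι hC hv hmem hω hα m).v = (D.walkJ hι hC hv hmem hω hα 0).v := by rw [walkJ_period]
  have hw : ((D.polyWalk hι hC hv hmem hω hα m).castEnd hend).comp.Homotopic (Path.refl _) := by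
    refine Walk.comp_homotopic_refl_of_forall_nodup _ fun b γ h0 hD hN ↦ ?_
    by_contra hγ
    rw [Walk.darts_castEnd, darts_polyWalk] at hD
    obtain ⟨Z, hZsx, hZess⟩ := D.exists_polyCycle_of_subwalk hι hC hv hmem hω hα hsx γ h0 hD hN hγ
    exact hZess (hZ Z hZsx)
  refine ⟨(Path.refl _).cast rfl (congrArg D.pos hend), fun θ ↦ rfl, ?_⟩
  have h1 : (D.polyWalk hι hC hv hmem hω hα m).comp =
      (((D.polyWalk hι hC hv hmem hω hα m).castEnd hend).comp).cast rfl (congrArg D.pos hend) := by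
    rw [Walk.comp_castEnd]; ext; rfl
  rw [h1]
  exact Path.Homotopic.cast' hw rfl _

end StarData

end Literature.Topology.PlanarFoliations
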